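import Literature.NumberTheory.LFunctions.MontgomeryZeroWindows
import Literature.NumberTheory.LFunctions.RodgersTaoZerosProofs

/-!
# RiemannHypothesis / UniversalFactor — `NarrowKernelNoGo` (stmt-RiemannHypothesis-2576), line `Sketch`:
stub K3, a jump of `N(t)` under RH is a real zero of `H_0`

The "dictionary" step of the zeta side of the line: under the Riemann hypothesis, if the zero
counting function jumps between `t₁ ≤ t₂`, `N(t₁) < N(t₂)`, then some ordinate `γ ∈ (t₁, t₂]`
satisfies `H_0(2γ) = 0`, where `H_0 = deBruijnH 0`, `H_0(z) = ξ(1/2 + iz/2)/8`.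

Proof: with `n := N(t₁)` the `n`-th ordinate `γ_n` satisfies `t₁ < γ_n ≤ t₂`
(`Montgomery.lt_zetaOrdinate_iff`, `Montgomery.zetaOrdinate_le_iff_lt`); `γ_n` is the ordinate of a
zero `ρ = σ + iγ_n` in the critical strip (`exists_zero_of_zetaOrdinate_holds`), which under RH has
`σ = 1/2` (`ρ` is neither a trivial zero nor the pole since `γ_n > 0`, `zetaOrdinate_pos_holds`);
finally `H_0(2γ) = 0 ↔ ζ(1/2 + iγ) = 0` (`deBruijnH_zero_two_mul_eq_zero_iff`).

References: Titchmarsh, *The Theory of the Riemann Zeta-Function* (1986), §9.1, §10.1.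
-/

noncomputable section

-- D-0017: `Summit.<S>.<S>.…` is the designed namespace of a single-problem summit.
set_option linter.dupNamespace false

namespace Summit.RiemannHypothesis.RiemannHypothesis.Theorems

open MeasureTheory Set Filter Complex intervalIntegral
open scoped Real Topology
open Literature.NumberTheory.LFunctions

/-- A jump of `N` between `t₁ ≤ t₂` is witnessed by the ordinate `γ_{N(t₁)} ∈ (t₁, t₂]`.
[cite: Titchmarsh1986, §9.1] -/
theorem UniversalFactor.narrowOrdinate_mem_of_lt {t₁ t₂ : ℝ}
    (h : zetaZeroCount t₁ < zetaZeroCount t₂) :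
    t₁ < zetaOrdinate (zetaZeroCount t₁) ∧ zetaOrdinate (zetaZeroCount t₁) ≤ t₂ :=
  ⟨Montgomery.lt_zetaOrdinate_iff.2 le_rfl, Montgomery.zetaOrdinate_le_iff_lt.2 h⟩

/-- Under RH every ordinate `γ_n` carries a critical zero: `ζ(1/2 + iγ_n) = 0` (the zero
`σ + iγ_n` of `exists_zero_of_zetaOrdinate_holds` is non-trivial and not the pole because
`γ_n > 0`, so RH gives `σ = 1/2`). [cite: Titchmarsh1986, §9.1] -/
theorem UniversalFactor.narrowOrdinate_riemannZeta_eq_zero (hRH : _root_.RiemannHypothesis) (n : ℕ) :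
    riemannZeta (1 / 2 + (zetaOrdinate n : ℂ) * I) = 0 := by
  obtain ⟨σ, -, -, hζ⟩ := exists_zero_of_zetaOrdinate_holds n
  have hpos : 0 < zetaOrdinate n := zetaOrdinate_pos_holds n
  have him : ((σ : ℂ) + (zetaOrdinate n : ℂ) * I).im = zetaOrdinate n := by
    simp [Complex.add_im, Complex.mul_im]
  have htriv : ¬∃ k : ℕ, (σ : ℂ) + (zetaOrdinate n : ℂ) * I = -2 * ((k : ℂ) + 1) := by
    rintro ⟨k, hk⟩
    have h := congrArg Complex.im hk
    rw [him] at h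
    simp at h
    exact hpos.ne' h
  have hone : (σ : ℂ) + (zetaOrdinate n : ℂ) * I ≠ 1 := by
    intro hk
    have h := congrArg Complex.im hk
    rw [him] at h
    simp at h
    exact hpos.ne' h
  have hre := hRH _ hζ htriv hone
  have hre' : σ = 1 / 2 := by
    simpa [Complex.add_re, Complex.mul_re] using hre
  rw [hre'] at hζ
  simpa using hζ

/-- **Stub K3 (dictionary, RH): a jump of `N` is a real zero of `H_0`.** Under RH, if
`N(t₁) < N(t₂)` (`t₁ ≤ t₂`) then some ordinate `γ ∈ (t₁, t₂]` has `H_0(2γ) = 0`: take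
`γ = γ_{N(t₁)}` (`Montgomery.lt_zetaOrdinate_iff`, `Montgomery.zetaOrdinate_le_iff_lt`), RH puts the
zero with this ordinate at `1/2 + iγ`, and `H_0(2γ) = 0 ↔ ζ(1/2 + iγ) = 0`
(`deBruijnH_zero_two_mul_eq_zero_iff`). [folklore] -/
theorem UniversalFactor.stub_narrowOrdinateZero : _root_.RiemannHypothesis → ∀ t₁ t₂ : ℝ, t₁ ≤ t₂ →
    zetaZeroCount t₁ < zetaZeroCount t₂ →
      ∃ γ : ℝ, t₁ < γ ∧ γ ≤ t₂ ∧ deBruijnH 0 ((2 * γ : ℝ) : ℂ) = 0 := by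
  intro hRH t₁ t₂ _ hlt
  obtain ⟨h₁, h₂⟩ := UniversalFactor.narrowOrdinate_mem_of_lt hlt
  refine ⟨zetaOrdinate (zetaZeroCount t₁), h₁, h₂, ?_⟩
  have hz := (deBruijnH_zero_two_mul_eq_zero_iff (zetaOrdinate (zetaZeroCount t₁))).2
    (UniversalFactor.narrowOrdinate_riemannZeta_eq_zero hRH _)
  push_cast
  exact hz

end Summit.RiemannHypothesis.RiemannHypothesis.Theorems
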